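import Literature.NumberTheory.EllipticCurves.KrizLi2019.EisensteinHeegnerLog
import Literature.NumberTheory.EllipticCurves.ComplexMultiplicationTwistIsogenyProofs
import Literature.NumberTheory.EllipticCurves.BSDQuadraticDescentTorsionOddPartProofs
import HarnessLib

/-!
# Rubin 1983, Theorem C at `p = 7` over a quadratic field: the Bernoulli criterion for
# `A(7)(M)` finite and `Ш(A(7)/M)[7^∞] = 0`, and the `7`-part of `Ш` of the even quadratic twists
# of `A(7) = X₀(49)`

Source: K. Rubin, *Congruences for special values of L-functions of elliptic curves with complex
multiplication*, Invent. math. 71 (1983) 339–364, doi:10.1007/bf01389102 (PUBLISHED, refereed;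
bib `Rubin1983`), §0, Theorem C (p. 341), whose proof "using the techniques of Gross' thesis" is
Buhler–Gross, *Arithmetic on elliptic curves with complex multiplication. II*, Invent. math. 79
(1985) 11–29 (bib `BuhlerGross1985`) and Rubin–Wiles (Progr. Math. 26, 1982). Read on the GDZ page
images of vol. 71 (`pub/bsd-stepL/lit/Rubin83_p339…p348.png`; transcription in
`pub/bsd-stepL/LIT-DOSSIER.md` §10.2). Requested by the cell `bsd-cm` (TARGET §8 **W20**; by-name
consumer: the rank-`0` "twin" input `hSd : ¬ 7 ∣ #Ш(W^{(d)})` of the Route-U instances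
`Summit…X12.O11.RouteU.bsdp_seven_of_twist_cm7_D11`, R185 (A)).

**Setting** (p. 339, verbatim): "Fix a prime `p > 3` such that the field `K = ℚ(√−p)` has class
number `1`. Thus `p = 7, 11, 19, 43, 67`, or `163`. View `ℚ̄` as a subfield of `ℂ` and fix an
embedding `ℚ̄ ↪ ℚ̄_p`. Let `ω : G(ℚ̄/ℚ) → μ_{p−1} ⊂ ℤ_p^*` be the Teichmuller character – the
Dirichlet character satisfying `ω(a) ≡ a (mod p)` for all `a ∈ ℤ`. For each such `p` there is a
unique elliptic curve `A(p)` defined over `ℚ` which over `K` attains complex multiplication by the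
full ring of integers `𝒪_K` of `K`, and has minimal discriminant ideal `(−p³)`. … Suppose `χ` is a
Dirichlet character of conductor `f`. We can identify `χ` with a character of `G(ℚ̄/ℚ)` …
`B_{1,χ} = f⁻¹ ∑_{a=1}^{f} χ(a) a`. … write `K(χ)` for the field obtained by adjoining to `K` the
values of `χ`, and `𝔭_χ` for the prime above `p` of `K(χ)` which corresponds to the embedding
`K(χ) ↪ ℚ̄_p` chosen above." (p. 340:) "If `X` is a `ℤ_p[G]`-module (or a `G`-module, in which
case replace `X` by `X ⊗ ℤ_p`) write `X^χ = {x ∈ X ⊗_{ℤ_p} B : x^σ = χ(σ)x for all σ ∈ G}`",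
`B = ℤ_p[values of χ]`.

**Theorem C** (p. 341, verbatim): "Suppose `M` is a finite abelian extension of `ℚ` of degree
prime to `p`, unramified at `p`. Let `E` be the curve `A(p)` and let `Ш_M` denote the `p`-primary
part of the Tate-Safarevic group of `E` over `M`. If `χ` is a character of `G(M/ℚ)` then
`E(M)^χ` is finite and `Ш_M^χ = 0 ⇔ χ(−1) = (−1)^{(p+1)/4}` and
`B_{1,χω^{(p−3)/4}} B_{1,χ̄ω^{(p−3)/4}} ≢ 0 (mod 𝔭_χ)`."

## What is vendored (the case the tree can state: `p = 7`, `M` quadratic)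

At `p = 7`: `A(7) = X₀(49)`, minimal model `y² + xy = x³ − x² − 2x − 1` of discriminant `−7³`
(the tree's `Literature.NumberTheory.EllipticCurves.cm7`, with `Δ_cm7`, `j_cm7 = −3375`);
`(p+1)/4 = 2`, `(p−3)/4 = 1`. For a QUADRATIC field `M = ℚ(√d_M)` with `7 ∤ d_M` (degree `2` is
prime to `7`; unramified at `7`) the two characters of `G(M/ℚ)` are `1` and the Kronecker character
`χ_M = (d_M/·)` (the tree's `KrizLi2019.IsKroneckerCharacterOf M`), both with values in `ℤ_7`
(`B = ℤ_7`, `𝔭_χ = (√−7)`, and for `x ∈ ℤ_7`: `x ≡ 0 (mod 𝔭_χ) ⇔ 7 ∣ x ⇔ ‖x‖₇ ≤ 7⁻¹` — the idiom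
of `KrizLi2019.thm120_padicLogHeegner_unit_of_bernoulli`). Since `7` is odd,
`E(M) ⊗ ℤ_7 = E(M)^1 ⊕ E(M)^{χ_M}` and `Ш_M = Ш_M^1 ⊕ Ш_M^{χ_M}`, so the CONJUNCTION of Theorem C
for the two characters reads: **`A(7)(M)` is finite and `Ш(A(7)/M)[7^∞] = 0` if and only if
`B_{1,ω}² ≢ 0 (mod 7)`, `χ_M(−1) = 1` (i.e. `M` is real) and `B_{1,χ_Mω}² ≢ 0 (mod 7)`** — this is
`thmC_seven_quadraticField` below (Bernoulli numbers of the PRIMITIVE characters, the tree's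
`KrizLi2019.bernoulliOnePrim`; `χ_Mω` has conductor `7|d_M|`). It is an immediate corollary of the
printed statement (two instances, summed), stated in the currency of
`KrizLi2019/EisensteinHeegnerLog.lean`; nothing is asserted (`def … : Prop`, D-0014), users take
`(h : thmC_seven_quadraticField)`.
-- TODO(general form): the six primes `p ∈ {7, 11, 19, 43, 67, 163}` with the curves `A(p)`, an
-- arbitrary abelian `M/ℚ` of degree prime to `p` unramified at `p`, and the `χ`-isotypic statement
-- as printed (needs `A(p)` for `p ≠ 7` and `χ`-components of `E(M) ⊗ ℤ_p[χ]` in the tree).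

## Proved here (the twist bookkeeping the cell asked for, R185 (A) / W20)

From the fact and the tree's quadratic descent of `Ш` at an odd prime
(`WeierstrassCurve.card_primaryComponent_sha_baseChange_quadratic_of_odd`, Dokchitser–Dokchitser
Lemma 4.14: `#Ш(E_M)[p^∞] = #Ш(E)[p^∞] · #Ш(E^{(d_M)})[p^∞]` when `E(M)` is finite):
* `card_primaryComponent_sha_eq_one_of_bernoulli`: under the three Bernoulli/sign conditions,
  `Ш(A(7)^{(d_M)}/ℚ)[7^∞]` and `Ш(A(7)/ℚ)[7^∞]` are trivial (any model `Wd` of the twist);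
* `not_dvd_shaOrder_twist_of_bernoulli`: hence, if `Ш(Wd)` is finite, `7 ∤ #Ш(Wd)` — the shape of
  the Route-U binder `hSd` for the even twists `49a1^{(d)}`, `d = d_M > 0`, `7 ∤ d`.
The `χ = 1` condition `7 ∤ B_{1,ω}` is TRUE (`∑_{a=1}^{6} ω(a)a ≡ 21 (mod 49)`, so
`B_{1,ω} ≡ 3 (mod 7)`) but is kept as a hypothesis here: it is discharged in the kernel by the
cell's `decide` certificates for Bernoulli units (`RouteUBernoulliCertificate.lean`), not by this
file.
-/

noncomputable section

open scoped Classical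

open NumberField WeierstrassCurve Literature.NumberTheory.EllipticCurves
  Literature.NumberTheory.EllipticCurves.KrizLi2019

namespace Literature.NumberTheory.EllipticCurves.Rubin1983

/-- `7` is prime (instance for `ℚ_[7]`, `ZMod 7`, `padicValNat 7`). [folklore] -/
instance fact_prime_seven : Fact (Nat.Prime 7) := ⟨by norm_num⟩

/-- Rubin's character `χω^{(p−3)/4}` at `p = 7` (`(p−3)/4 = 1`) for a character `χ` modulo `d`:
the product `χ · ω` computed at the common level `d · 7` (Mathlib `changeLevel`); its Bernoulli
number `B_{1,χω}` is taken on the PRIMITIVE character it induces (`bernoulliOnePrim`), as in the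
paper ("Dirichlet character of conductor `f`", p. 339). A definition; nothing asserted.
[cite: Rubin1983, §0 Thm. C (p. 341, the character χω^{(p−3)/4})] -/
def mulTeichmuller {d : ℕ} (χ : DirichletCharacter ℚ_[7] d) (ω : DirichletCharacter ℚ_[7] 7) :
    DirichletCharacter ℚ_[7] (d * 7) :=
  DirichletCharacter.changeLevel (dvd_mul_right d 7) χ *
    DirichletCharacter.changeLevel (dvd_mul_left 7 d) ω

/-- **Rubin 1983, Theorem C, at `p = 7` over a quadratic field** (Invent. math. 71 (1983) p. 341,
verbatim in the module docstring; the two instances `χ = 1` and `χ = χ_M` of the printed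
`χ`-isotypic statement, summed — `7` is odd, so `E(M) ⊗ ℤ_7` and `Ш(E/M)[7^∞]` are the direct sums
of their two eigenspaces). Let `ω` be the Teichmüller character modulo `7` (read in `ℚ_7`), `M` a
quadratic number field with `7 ∤ d_M` ("finite abelian extension of `ℚ` of degree prime to `p`,
unramified at `p`"), `χ_M` its Kronecker character modulo `|d_M|`, and `W'` any Weierstrass model
over `M` of `A(7) = X₀(49)` (the tree's `cm7`, `y² + xy = x³ − x² − 2x − 1`, discriminant `−7³`).
Then `A(7)(M)` is finite and the `7`-primary part of `Ш(A(7)/M)` is trivial, if and only if: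
`B_{1,ω} · B_{1,ω} ≢ 0 (mod 7)`, `χ_M(−1) = 1 = (−1)^{(7+1)/4}` (`M` real quadratic), and
`B_{1,χ_Mω} · B_{1,χ_Mω} ≢ 0 (mod 7)` (generalised Bernoulli numbers `B_{1,χ} = f⁻¹∑_{a=1}^f χ(a)a`
of the primitive characters, conductor `f`; "`≢ 0 (mod 𝔭_χ)`" for `7`-adic integers is
`¬ ‖·‖₇ ≤ 7⁻¹`). Named fact (PUBLISHED; proof in Buhler–Gross 1985 / Rubin–Wiles 1982); nothing
asserted; users take `(h : thmC_seven_quadraticField)`.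
-- TODO(general form): all six `p`, general abelian `M`, `χ`-isotypic components (module docstring).
[cite: Rubin1983, §0 Thm. C (p. 341), with the setting of pp. 339–340 (A(p), ω, B_{1,χ}, 𝔭_χ, X^χ)]
[cite: BuhlerGross1985, (proof of Rubin's Thm. C, "techniques of Gross' thesis")] -/
def thmC_seven_quadraticField : Prop :=
  ∀ (ω : DirichletCharacter ℚ_[7] 7), IsTeichmullerCharacter ω →
  ∀ (M : Type) [Field M] [NumberField M] [NeZero (NumberField.discr M).natAbs],
    Module.finrank ℚ M = 2 → ¬ ((7 : ℤ) ∣ NumberField.discr M) →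
  ∀ (εM : DirichletCharacter ℚ_[7] (NumberField.discr M).natAbs), IsKroneckerCharacterOf M εM →
  ∀ (W' : WeierstrassCurve M) [W'.IsElliptic],
    (∃ C : VariableChange M, C • cm7.baseChange M = W') →
    ((Finite W'.toAffine.Point ∧ Nat.card (AddCommGroup.primaryComponent W'.sha 7) = 1) ↔
      (¬ ‖bernoulliOnePrim ω * bernoulliOnePrim ω‖ ≤ (7 : ℝ)⁻¹ ∧
        εM.Even ∧
        ¬ ‖bernoulliOnePrim (mulTeichmuller εM ω) * bernoulliOnePrim (mulTeichmuller εM ω)‖ ≤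
            (7 : ℝ)⁻¹))

/-! ### Proved consequences: the `7`-part of `Ш` of the even quadratic twists of `A(7)` -/

/-- `cm7` base-changed to a number field is an elliptic curve (`Δ = −7³ ≠ 0`). [folklore] -/
instance isElliptic_cm7_baseChange (M : Type) [Field M] [NumberField M] :
    (cm7.baseChange M).IsElliptic := by
  rw [baseChange]; infer_instance

/-- **Rubin's Theorem C read on the twist.** Under the fact, for a quadratic field `M` with
`7 ∤ d_M`, its Kronecker character `χ_M`, the Teichmüller character `ω` mod `7`, and ANY model `Wd`
over `ℚ` of the quadratic twist `A(7)^{(d_M)}`: if `7 ∤ B_{1,ω}²`, `χ_M` is even and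
`7 ∤ B_{1,χ_Mω}²`, then the `7`-primary parts of `Ш(A(7)^{(d_M)}/ℚ)` and of `Ш(A(7)/ℚ)` are
trivial. Proof: Theorem C gives `A(7)(M)` finite and `Ш(A(7)/M)[7^∞] = 0`, and the tree's odd-`p`
quadratic descent `#Ш(A(7)_M)[7^∞] = #Ш(A(7))[7^∞] · #Ш(A(7)^{(d_M)})[7^∞]`
(`WeierstrassCurve.card_primaryComponent_sha_baseChange_quadratic_of_odd`) splits the `1`.
This is the bookkeeping "`E(M)^χ ↔ E^χ(ℚ)`, `[M:ℚ] = 2`" of the cell's W20, done in the kernel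
on orders. [cite: Rubin1983, §0 Thm. C (p. 341)] -/
theorem card_primaryComponent_sha_eq_one_of_bernoulli (h : thmC_seven_quadraticField)
    (ω : DirichletCharacter ℚ_[7] 7) (hω : IsTeichmullerCharacter ω)
    (M : Type) [Field M] [NumberField M] [NeZero (NumberField.discr M).natAbs]
    (h2 : Module.finrank ℚ M = 2) (h7 : ¬ ((7 : ℤ) ∣ NumberField.discr M))
    (εM : DirichletCharacter ℚ_[7] (NumberField.discr M).natAbs) (hε : IsKroneckerCharacterOf M εM)
    (hB₁ : ¬ ‖bernoulliOnePrim ω * bernoulliOnePrim ω‖ ≤ (7 : ℝ)⁻¹) (heven : εM.Even)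
    (hB₂ : ¬ ‖bernoulliOnePrim (mulTeichmuller εM ω) * bernoulliOnePrim (mulTeichmuller εM ω)‖ ≤
        (7 : ℝ)⁻¹)
    (Wd : WeierstrassCurve ℚ) [Wd.IsElliptic]
    (hWd : ∃ C : VariableChange ℚ, C • cm7.quadraticTwist (NumberField.discr M : ℚ) = Wd) :
    Nat.card (AddCommGroup.primaryComponent Wd.sha 7) = 1 ∧
      Nat.card (AddCommGroup.primaryComponent cm7.sha 7) = 1 := by
  have hW' : ∃ C : VariableChange M, C • cm7.baseChange M = cm7.baseChange M := ⟨1, one_smul _ _⟩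
  obtain ⟨hfin, hsha⟩ :=
    (h ω hω M h2 h7 εM hε (cm7.baseChange M) hW').mpr ⟨hB₁, heven, hB₂⟩
  haveI : Finite (cm7.baseChange M).toAffine.Point := hfin
  have hprod := WeierstrassCurve.card_primaryComponent_sha_baseChange_quadratic_of_odd cm7 M h2 Wd
    hWd (cm7.baseChange M) hW' 7 (by norm_num)
  rw [hsha] at hprod
  exact ⟨Nat.eq_one_of_mul_eq_one_left hprod.symm, Nat.eq_one_of_mul_eq_one_right hprod.symm⟩

/-- **The Route-U twin binder `hSd`.** Under the fact and the three conditions of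
`card_primaryComponent_sha_eq_one_of_bernoulli`, for any model `Wd/ℚ` of `A(7)^{(d_M)}` whose
`Ш` is finite: `7 ∤ #Ш(Wd)`. (From `#Ш[7^∞] = 7^{v₇(#Ш)} = 1`,
`Literature.NumberTheory.EllipticCurves.natCard_primaryComponent_eq_pow_padicValNat`.)
[cite: Rubin1983, §0 Thm. C (p. 341)] -/
theorem not_dvd_shaOrder_twist_of_bernoulli (h : thmC_seven_quadraticField)
    (ω : DirichletCharacter ℚ_[7] 7) (hω : IsTeichmullerCharacter ω)
    (M : Type) [Field M] [NumberField M] [NeZero (NumberField.discr M).natAbs]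
    (h2 : Module.finrank ℚ M = 2) (h7 : ¬ ((7 : ℤ) ∣ NumberField.discr M))
    (εM : DirichletCharacter ℚ_[7] (NumberField.discr M).natAbs) (hε : IsKroneckerCharacterOf M εM)
    (hB₁ : ¬ ‖bernoulliOnePrim ω * bernoulliOnePrim ω‖ ≤ (7 : ℝ)⁻¹) (heven : εM.Even)
    (hB₂ : ¬ ‖bernoulliOnePrim (mulTeichmuller εM ω) * bernoulliOnePrim (mulTeichmuller εM ω)‖ ≤
        (7 : ℝ)⁻¹)
    (Wd : WeierstrassCurve ℚ) [Wd.IsElliptic] [Finite Wd.sha]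
    (hWd : ∃ C : VariableChange ℚ, C • cm7.quadraticTwist (NumberField.discr M : ℚ) = Wd) :
    ¬ 7 ∣ Wd.shaOrder := by
  have h1 := (card_primaryComponent_sha_eq_one_of_bernoulli h ω hω M h2 h7 εM hε hB₁ heven hB₂
    Wd hWd).1
  rw [natCard_primaryComponent_eq_pow_padicValNat 7] at h1
  have hv : padicValNat 7 (Nat.card Wd.sha) = 0 := by
    rcases Nat.pow_eq_one.mp h1 with h | h
    · norm_num at h
    · exact h
  have hpos : Nat.card Wd.sha ≠ 0 := (Nat.card_pos (α := Wd.sha)).ne'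
  intro hdvd
  have := (padicValNat.eq_zero_iff.mp hv)
  rcases this with h | h | h
  · norm_num at h
  · exact hpos h
  · exact h hdvd

end Literature.NumberTheory.EllipticCurves.Rubin1983

end
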